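import Summits.QuantumFields.YangMills.Theorems.UnitScaleTiltProp7SectET3DeltaPiT3PInv
import Summits.QuantumFields.YangMills.Theorems.UnitScaleTiltProp7SectET3GaugeProjectorT3Rows
import Summits.QuantumFields.YangMills.Theorems.UnitScaleTiltProp7SectET3DeltaPiT3Rows
import HarnessLib

/-!
# Route `UnitScaleTilt`, crux K1 «MinimiserStabilityRegPr» (stmt-QuantumFields-19200), EX face after S45, row `hPcol` — **P1: THE OPERATOR REDUCTION OF `hPcol`'s COLUMN
# OPERATOR TO THE LOD LINE: under `R_S = projR Δ^η_{U₀} Q″` (the Lift antecedent, ✓`RS_eq_projR_of_lift`), `G′ᴾ(R_S u) = (1 − P₀)(G_a(R_S u))` and `Q″(G_a(R_S u)) = 0`** —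
# the tree's Moore–Penrose `G′ᴾ` of `Δ′_a = D*D + a′(Qk∘D)†(Qk∘D)` (RULING g28-№4 (C2′)) agrees, on the range of the gauge projector, with the LOD line's massive site propagator
# `G_a = (Δ^η_{U₀} + aQ″†Q″)⁻¹` up to the finite-rank projection `P₀` onto `ker D_{U₀}` (px5 g12 LOCATE-hPcol 9923ee3f §2, chair ★p1 g25 ask 05:53:56Z)

Cell `ym3-torus` (HUMAN RULING D-0037; rung R3 = SU(2) YM₃ on T³ — NOT d = 4, NOT infinite volume, NOT a mass gap, NOT Clay).  Width seat `ym3-torus-px5` (gen 12).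
THEOREMS ONLY (0 `def`, 0 `sorry`, default heartbeats); `--supports stmt-QuantumFields-19200 --as helper`; count-neutral.

WHY.  The EX row `hPcol` (✓`minimiserStabilityRegPr_of_EXrowsS44LG` :243–252) bounds the ℓ¹ column sum of `G′ᴾ ∘ R_S ∘ D*_{U₀}` against a bond spike.  `G′ᴾ` is NOT the LOD propagator:
it is `(Δ′_a + P₀)⁻¹ − P₀` for the tree's intrinsic `Δ′_a` (`…SectET3DeltaPiT3PInv`).  But on the RANGE OF `R_S` the two agree up to `P₀`: under the Lift antecedent `R_S = projR Δ^η Q″`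
projects onto `Δ^η(ker Q″)`, so `R_S u = Δ^ην₀` with `Q″ν₀ = 0`; the LOD letter `hGA` gives `G_a(Δ^ην₀) = ν₀` (the penalty vanishes on `ker Q″`); `hker : ker Q″ ≤ N_S` and
✓`laplacePrimeA_apply_of_mem_NS` give `Δ′_aν₀ = Δ^ην₀`, and ✓`GprimeP_laplacePrimeA` gives `G′ᴾ(Δ′_aν₀) = ν₀ − P₀ν₀`.  Hence `G′ᴾ ∘ R_S = (1 − P₀) ∘ G_a ∘ R_S` and in particular
`G′ᴾ R_S D* = (1 − P₀) G_a (1 − P) D*` with `P = 1 − projR` the operator of V5∕V5b∕V6 — the reduction that puts `hPcol` on the (L3′b) VALUE∕GRAD book (LOCATE-hPcol §3: by duality `hPcol` is then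
the sup→sup bound of `D_{U₀} G_a (1 − P)`, a GRADIENT row-sum).
WHAT IS PROVED (ns `Summit.QuantumFields.YangMills.Theorems.Prop7PcolOperatorReduction`; LOD letters `Q″ ι T G hGA` in hypothesis form as in ✓`Prop7ComplementaryProjectorBlockDecay`;
the Lift consequences `hRS : RS U₀ = projR (covLapSite U₀) Q″` and `hker : ker Q″ ≤ N_S U₀` DISPLAYED — both are ✓`RS_eq_projR_of_lift`'s conclusion∕hypothesis).
* §1 `projR_apply_mem` (`projR Δ Q″ x ∈ (ker Q″).map Δ`), ★`exists_ker_preimage_of_RS` (`∃ ν₀, Q″ν₀ = 0 ∧ Δ^ην₀ = R_S u`), ★`G_RS_eq_and_mem_ker`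
  (`Q″(G_a(R_S u)) = 0 ∧ Δ^η(G_a(R_S u)) = R_S u`).
* §2 ★★★ `GprimeP_RS_eq` — `GprimeP a′ U₀ (RS U₀ u) = G (RS U₀ u) − kerDProj U₀ (G (RS U₀ u))` for EVERY site field `u` and every `0 ≤ a′`; ★★ `GprimeP_RS_DstarL2_eq` — the same at `u := D*_{U₀}w`
  (hPcol's operator); `DL2_GprimeP_RS_eq` — `D_{U₀}(G′ᴾ(R_S u)) = D_{U₀}(G_a(R_S u))` (`D P₀ = 0`, ✓`DL2_kerDProj`): the transposed (row-sum) reading of `hPcol` sees NO `P₀` at all.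
HYP-SAT (★★OWNER RULING №42): `hGA` ⟸ px5 g11 ✓`exists_massive_inverse`; `hRS`, `hker` ⟸ ✓`RS_eq_projR_of_lift` ∕ ✓`exists_RS_eq_projR_of_lift` under the row's own Lift antecedent + `RegPr`
+ `10¹²L³ε₀ ≤ 1` (the S44ᴸγ face carries exactly these); `0 ≤ a′` literal.  Nothing eventual; the conclusion is an identity (non-vacuous).
HONEST SCOPE.  Linear algebra over landed letters; no estimate; `hPcol` is NOT proved here (its analytic content is the gradient row-sum of `G_a`, LOCATE-hPcol §3–§4); nothing of the ten EX rows,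
`hT`, `hGF`, EX `stub_existenceMinimalOrbit` or the crux is proved; the Yang–Mills mass gap is NOT proved.

References: T. Bałaban, CMP **99** (1985) 389–434 [Balaban1985BackgroundPropagators] ((3.20)–(3.25) p.394, (3.118)–(3.122) pp.419–420); CMP **102** (1985) 277–309 [Balaban1985Variational]
((138)–(139) p.299 «`G′RD*` is a bounded operator in the norm |·|₍₁₎»).
-/

set_option autoImplicit false

noncomputable section

open scoped BigOperators Matrix.Norms.L2Operator InnerProductSpace ComplexConjugate

namespace Summit.QuantumFields.YangMills.Theorems.Prop7PcolOperatorReduction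

open Literature.MathematicalPhysics.QuantumFieldTheory.Balaban1983to89
open Literature.MathematicalPhysics.QuantumFieldTheory.Balaban1983to89.T3ContinuumYM3Torus
open B11Eq103H1Complex (SiteL2K BondL2K projR)
open Summit.QuantumFields.YangMills.Theorems.Prop7SectET3Transport (periodsT3)
open Summit.QuantumFields.YangMills.Theorems.Prop7SectET3HilbertLetters (W₂ toL2 toL2S DL2 DstarL2 covLapSite)
open Summit.QuantumFields.YangMills.Theorems.Prop7SectET3GaugeProjector (NS RS)
open Summit.QuantumFields.YangMills.Theorems.Prop7SectET3DeltaPi (laplacePrimeA laplacePrimeA_apply_of_mem_NS)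
open Summit.QuantumFields.YangMills.Theorems.Prop7SectET3DeltaPiPInv (kerDProj GprimeP GprimeP_laplacePrimeA DL2_kerDProj)

variable (F : T3Family) {n K : ℕ} (h : n ≤ K) {c₀ c₁ cB : ℝ} [Fact (0 < c₀)] [Fact (0 < c₁)] [Fact (0 < cB)]
  (U₀ : GaugeField (F.P K) 0 (Matrix.specialUnitaryGroup (Fin 2) ℂ))
  (Q'' : SiteL2K ℂ 3 (periodsT3 F K) c₀ W₂ →ₗ[ℂ] (Site (F.P K) (K - n) → Matrix (Fin 2) (Fin 2) ℂ))
  (ι : (Site (F.P K) (K - n) → Matrix (Fin 2) (Fin 2) ℂ) →ₗ[ℂ] SiteL2K ℂ 3 (periodsT3 F n) c₁ W₂)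
  (T : SiteL2K ℂ 3 (periodsT3 F n) c₁ W₂ →ₗ[ℂ] SiteL2K ℂ 3 (periodsT3 F K) c₀ W₂)
  {a : ℝ}
  (G : SiteL2K ℂ 3 (periodsT3 F K) c₀ W₂ →ₗ[ℂ] SiteL2K ℂ 3 (periodsT3 F K) c₀ W₂)
  (hGA : ∀ u, G (covLapSite F n K c₀ U₀ u + (a : ℂ) • T (ι (Q'' u))) = u)
  (hRS : RS F n K h c₀ cB U₀ = projR (covLapSite F n K c₀ U₀) Q'')
  (hker : LinearMap.ker Q'' ≤ NS F n K h c₀ cB U₀)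

/-! ## §1 The range of the gauge projector under Lift, and what `G_a` does there -/

omit [Fact (0 < c₁)] [Fact (0 < cB)] in
/-- `projR Δ Q″ x` lies in `Δ(ker Q″)` (it is the orthogonal projection onto that subspace). [cite: Balaban1985BackgroundPropagators, (3.20)–(3.21) p.394] -/
theorem projR_apply_mem (x : SiteL2K ℂ 3 (periodsT3 F K) c₀ W₂) :
    projR (covLapSite F n K c₀ U₀) Q'' x ∈ (LinearMap.ker Q'').map (covLapSite F n K c₀ U₀) := by
  haveI : CompleteSpace ((LinearMap.ker Q'').map (covLapSite F n K c₀ U₀)) := FiniteDimensional.complete ℂ _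
  simp only [projR, ContinuousLinearMap.coe_coe]
  exact Submodule.starProjection_apply_mem _ x

include hRS in
omit [Fact (0 < c₁)] [Fact (0 < cB)] in
/-- ★ **UNDER LIFT, `R_S u = Δ^ην₀` WITH `Q″ν₀ = 0`.** [cite: Balaban1985BackgroundPropagators, (3.21) p.394, (3.118) p.419] -/
theorem exists_ker_preimage_of_RS (u : SiteL2K ℂ 3 (periodsT3 F K) c₀ W₂) :
    ∃ ν₀ : SiteL2K ℂ 3 (periodsT3 F K) c₀ W₂, Q'' ν₀ = 0 ∧ covLapSite F n K c₀ U₀ ν₀ = RS F n K h c₀ cB U₀ u := by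
  have hmem : RS F n K h c₀ cB U₀ u ∈ (LinearMap.ker Q'').map (covLapSite F n K c₀ U₀) := by
    rw [hRS]; exact projR_apply_mem F U₀ Q'' u
  obtain ⟨ν₀, hν₀, hΔ⟩ := Submodule.mem_map.1 hmem
  exact ⟨ν₀, LinearMap.mem_ker.1 hν₀, hΔ⟩

include hGA hRS in
omit [Fact (0 < c₁)] [Fact (0 < cB)] in
/-- ★ **`G_a` INVERTS `Δ^η` ON THE RANGE OF THE GAUGE PROJECTOR**: `Δ^η(G_a(R_S u)) = R_S u` and `Q″(G_a(R_S u)) = 0` — the penalty `aQ″†Q″` vanishes on `ker Q″`, so `G_a(Δ^ην₀) = ν₀` by `hGA`.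
[cite: Balaban1985BackgroundPropagators, (3.24)–(3.25) p.394, (3.118) p.419] -/
theorem G_RS_eq_and_mem_ker (u : SiteL2K ℂ 3 (periodsT3 F K) c₀ W₂) :
    Q'' (G (RS F n K h c₀ cB U₀ u)) = 0 ∧ covLapSite F n K c₀ U₀ (G (RS F n K h c₀ cB U₀ u)) = RS F n K h c₀ cB U₀ u := by
  obtain ⟨ν₀, hQ, hΔ⟩ := exists_ker_preimage_of_RS F h U₀ Q'' hRS u
  have hG : G (RS F n K h c₀ cB U₀ u) = ν₀ := by
    have h1 := hGA ν₀
    rw [hQ, map_zero, map_zero, smul_zero, add_zero, hΔ] at h1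
    exact h1
  rw [hG]
  exact ⟨hQ, hΔ⟩

/-! ## §2 `G′ᴾ` on the range of `R_S` IS `(1 − P₀) G_a` -/

include hGA hRS hker in
omit [Fact (0 < c₁)] in
/-- ★★★ **`G′ᴾ(R_S u) = G_a(R_S u) − P₀(G_a(R_S u))` FOR EVERY SITE FIELD `u` AND EVERY `0 ≤ a′`** (under Lift: `hRS`, `hker`): with `ν₀ := G_a(R_S u) ∈ ker Q″ ≤ N_S` and `Δ^ην₀ = R_S u` (§1),
`Δ′_{a′}ν₀ = Δ^ην₀` (✓`laplacePrimeA_apply_of_mem_NS`) and `G′ᴾ(Δ′_{a′}ν₀) = ν₀ − P₀ν₀` (✓`GprimeP_laplacePrimeA`). [cite: Balaban1985BackgroundPropagators, (3.25) p.394, (3.118)–(3.122) pp.419–420] -/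
theorem GprimeP_RS_eq {a' : ℝ} (ha' : 0 ≤ a') (u : SiteL2K ℂ 3 (periodsT3 F K) c₀ W₂) :
    GprimeP F n K h c₀ cB a' U₀ (RS F n K h c₀ cB U₀ u)
      = G (RS F n K h c₀ cB U₀ u) - kerDProj F n K c₀ U₀ (G (RS F n K h c₀ cB U₀ u)) := by
  obtain ⟨hQ, hΔ⟩ := G_RS_eq_and_mem_ker F h U₀ Q'' ι T G hGA hRS u
  have hNS : G (RS F n K h c₀ cB U₀ u) ∈ NS F n K h c₀ cB U₀ := hker (LinearMap.mem_ker.2 hQ)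
  have hΔ' : laplacePrimeA F n K h c₀ cB a' U₀ (G (RS F n K h c₀ cB U₀ u)) = RS F n K h c₀ cB U₀ u := by
    rw [laplacePrimeA_apply_of_mem_NS U₀ hNS, hΔ]
  have key := GprimeP_laplacePrimeA (n := n) (h := h) (cB := cB) ha' U₀ (G (RS F n K h c₀ cB U₀ u))
  rw [hΔ'] at key
  exact key

include hGA hRS hker in
omit [Fact (0 < c₁)] in
/-- ★★ **hPcol's OPERATOR**: `G′ᴾ(R_S(D*_{U₀}w)) = G_a(R_S(D*_{U₀}w)) − P₀(G_a(R_S(D*_{U₀}w)))` for every vector field `w` — with `R_S = 1 − P` this is `(1 − P₀)G_a(1 − P)D*w`, the LOD objects of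
V4∕V5∕V6. [cite: Balaban1985Variational, (138)–(139) p.299; Balaban1985BackgroundPropagators, (3.25) p.394] -/
theorem GprimeP_RS_DstarL2_eq {a' : ℝ} (ha' : 0 ≤ a') (w : BondL2K ℂ 3 (periodsT3 F K) c₀ W₂) :
    GprimeP F n K h c₀ cB a' U₀ (RS F n K h c₀ cB U₀ (DstarL2 F n K c₀ U₀ w))
      = G (RS F n K h c₀ cB U₀ (DstarL2 F n K c₀ U₀ w)) - kerDProj F n K c₀ U₀ (G (RS F n K h c₀ cB U₀ (DstarL2 F n K c₀ U₀ w))) :=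
  GprimeP_RS_eq F h U₀ Q'' ι T G hGA hRS hker ha' _

include hGA hRS hker in
omit [Fact (0 < c₁)] in
/-- **THE TRANSPOSED READING SEES NO `P₀`**: `D_{U₀}(G′ᴾ(R_S u)) = D_{U₀}(G_a(R_S u))` (`D P₀ = 0`, ✓`DL2_kerDProj`) — so the ℓ^∞ row sum of `D ∘ R_S ∘ G′ᴾ = (G′ᴾ R_S D*)†` that `hPcol`
measures by duality is that of `D_{U₀} G_a (1 − P)`. [cite: Balaban1985Variational, (138)–(139) p.299] -/
theorem DL2_GprimeP_RS_eq {a' : ℝ} (ha' : 0 ≤ a') (u : SiteL2K ℂ 3 (periodsT3 F K) c₀ W₂) :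
    DL2 F n K c₀ U₀ (GprimeP F n K h c₀ cB a' U₀ (RS F n K h c₀ cB U₀ u)) = DL2 F n K c₀ U₀ (G (RS F n K h c₀ cB U₀ u)) := by
  rw [GprimeP_RS_eq F h U₀ Q'' ι T G hGA hRS hker ha', map_sub, DL2_kerDProj, sub_zero]

end Summit.QuantumFields.YangMills.Theorems.Prop7PcolOperatorReduction

end
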